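import Summits.SmoothPoincare4.SmoothPoincare4.Theorems.ConvexBisectionAcyclicBisectionExistsChartedChainChordSign
import Mathlib.Analysis.SpecialFunctions.Trigonometric.Bounds
import HarnessLib

/-!
# The round four-point loop of the `e_1`-curve: plane geometry
(wave 7, brick H5-1 of the last geometric input (R-E1CURVE) of node N3a `node_STcurve` of stub
`stub_STgeo` = NF4 N3, line `modp-braid-orbits`, crux `ConvexBisection.AcyclicBisectionExists`,
item stmt-SmoothPoincare4-10508; registered sub-goal `helper_eOne_radii`)

The remaining curve of N3a (report G6 §3) is the lift to one sheet of the page `page g 1` of the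
ROUND loop of the `x`-plane enclosing the four consecutive branch points `ζ_0, ζ_1, ζ_2, ζ_3`
(`ζ_k = e^{i(2k+1)a}`, `a = π/(2g+1)`) and no other.  With `ϖ = ω² = e^{4ia}` (`ω = rootU (2g+1)`)
the loop is the circle of centre `c₀ = (2/5) ϖ` (`eoCenter`) and radius `R = ‖ϖ − 2/5‖`
(`eoRad`, `R² = 1 + 4/25 − (4/5) cos 4a`); in the rotated coordinate `x' = x ϖ⁻¹` the branch points
sit at the angles `(2k−3)a` and the circle is `‖x' − 2/5‖ = R`, through `e^{±4ia}`.  This file is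
pure plane geometry (everything in `c = cos a ≥ 0.8`, Chebyshev polynomials for `cos 3a, cos 4a,
cos 5a`):

* §1 the angle `a`, `ω = e^{2ia}`, `ζ_k = ϖ e^{i((2k+1)a − 4a)}`, bounds on `cos a`;
* §2 the radius: `‖e^{iθ} − t‖² = 1 + t² − 2t cos θ`; the four enclosed branch points are at distance
  `< R − 5κ` from `c₀`, all others at distance `> R + 2κ` (`κ = (1 − cos a)/10`, `eoKap`), and
  `2/5 + R + κ ≤ 1.78`;
* registered: **`helper_eOne_radii`** — the two distance statements of §2 in closed form.

The sequel `…EOneCurveSeparation.lean` separates the circle from the chords of Y4's model chain.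
Everything is proved; no `sorry`.  References: J. Milnor, *Singular points of complex
hypersurfaces* (1968), §9 [Milnor1968]; B. Farb, D. Margalit, *A primer on mapping class groups*
(2012), §6.1 [FarbMargalit2012].
-/

noncomputable section

set_option linter.dupNamespace false

open scoped Manifold ContDiff Topology ComplexConjugate Real
open Set Function Metric Complex
open Literature.Topology.FourManifolds Literature.Topology.FourManifolds.LefschetzBase
  Literature.Topology.FourManifolds.TorusKnotMilnor

namespace Summit.SmoothPoincare4.SmoothPoincare4.Theorems.AcyclicBisectionExists.ModpBraidOrbits

variable {g : ℕ}

/-! ## §1 Angles and the cyclic root -/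

/-- `θ_k = (2k+1) θ_0`. [folklore] -/
theorem branchAngle_eq_mul (g k : ℕ) : branchAngle g k = (2 * k + 1) * branchAngle g 0 := by
  unfold branchAngle; push_cast; ring

/-- `θ_0 = π/(2g+1) > 0`. [folklore] -/
theorem branchAngle_zero_pos (g : ℕ) : 0 < branchAngle g 0 := by
  unfold branchAngle; positivity

/-- `(2g+1) θ_0 = π`. [folklore] -/
theorem mul_branchAngle_zero (g : ℕ) : (2 * g + 1 : ℝ) * branchAngle g 0 = π := by
  unfold branchAngle
  have h0 : (2 * (g : ℝ) + 1) ≠ 0 := by positivity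
  field_simp
  push_cast; ring

/-- `θ_0 ≤ π/5` for `g ≥ 2`. [folklore] -/
theorem branchAngle_zero_le (hg : 2 ≤ g) : branchAngle g 0 ≤ π / 5 := by
  unfold branchAngle
  have hg' : (2 : ℝ) ≤ g := by exact_mod_cast hg
  have h0 : (0 : ℝ) < 2 * g + 1 := by positivity
  rw [div_le_div_iff₀ h0 (by norm_num : (0:ℝ) < 5)]
  push_cast
  nlinarith [Real.pi_pos]

/-- `θ_0 ≤ π/7` for `g ≥ 3`. [folklore] -/
theorem branchAngle_zero_le' (hg : 3 ≤ g) : branchAngle g 0 ≤ π / 7 := by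
  unfold branchAngle
  have hg' : (3 : ℝ) ≤ g := by exact_mod_cast hg
  have h0 : (0 : ℝ) < 2 * g + 1 := by positivity
  rw [div_le_div_iff₀ h0 (by norm_num : (0:ℝ) < 7)]
  push_cast
  nlinarith [Real.pi_pos]

/-- **`cos θ_0 ≥ 4/5`** for `g ≥ 2` (`1 − x²/2 ≤ cos x`, `x ≤ π/5`). [folklore] -/
theorem cmid_ge (hg : 2 ≤ g) : 4 / 5 ≤ cmid g := by
  have h := Real.one_sub_sq_div_two_le_cos (x := branchAngle g 0)
  have h1 := branchAngle_zero_le hg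
  have h2 := branchAngle_zero_pos g
  have hpi := Real.pi_lt_d2
  have h3 : branchAngle g 0 ^ 2 ≤ (3.15 / 5) ^ 2 := by
    have : branchAngle g 0 ≤ 3.15 / 5 := by linarith
    nlinarith
  unfold cmid
  nlinarith

/-- **`cos θ_0 ≥ 0.89`** for `g ≥ 3`. [folklore] -/
theorem cmid_ge' (hg : 3 ≤ g) : 0.89 ≤ cmid g := by
  have h := Real.one_sub_sq_div_two_le_cos (x := branchAngle g 0)
  have h1 := branchAngle_zero_le' hg
  have h2 := branchAngle_zero_pos g
  have hpi := Real.pi_lt_d2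
  have h3 : branchAngle g 0 ^ 2 ≤ (3.15 / 7) ^ 2 := by
    have : branchAngle g 0 ≤ 3.15 / 7 := by linarith
    nlinarith
  unfold cmid
  nlinarith

/-- `cos θ_0 < 1` (`g ≥ 1`). [folklore] -/
theorem cmid_lt_one (hg : 1 ≤ g) : cmid g < 1 := by
  have h1 := cmid_sq_add_shalf_sq g
  have h2 := shalf_pos hg
  have h3 : cmid g ≤ 1 := Real.cos_le_one _
  nlinarith

/-- `cos 3θ_0 = 4c³ − 3c`. [folklore] -/
theorem cos_three_a (g : ℕ) : Real.cos (3 * branchAngle g 0) = 4 * cmid g ^ 3 - 3 * cmid g := by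
  rw [Real.cos_three_mul]; rfl

/-- `cos 4θ_0 = 8c⁴ − 8c² + 1`. [folklore] -/
theorem cos_four_a (g : ℕ) : Real.cos (4 * branchAngle g 0) = 8 * cmid g ^ 4 - 8 * cmid g ^ 2 + 1 := by
  rw [show 4 * branchAngle g 0 = 2 * (2 * branchAngle g 0) by ring, Real.cos_two_mul, Real.cos_two_mul]
  unfold cmid; ring

/-- `sin 4θ_0 = 4 s c (2c² − 1)`. [folklore] -/
theorem sin_four_a (g : ℕ) :
    Real.sin (4 * branchAngle g 0) = 4 * shalf g * cmid g * (2 * cmid g ^ 2 - 1) := by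
  rw [show 4 * branchAngle g 0 = 2 * (2 * branchAngle g 0) by ring, Real.sin_two_mul, Real.sin_two_mul,
    Real.cos_two_mul]
  unfold cmid shalf; ring

/-- `cos 5θ_0 = 16c⁵ − 20c³ + 5c`. [folklore] -/
theorem cos_five_a (g : ℕ) :
    Real.cos (5 * branchAngle g 0) = 16 * cmid g ^ 5 - 20 * cmid g ^ 3 + 5 * cmid g := by
  rw [show 5 * branchAngle g 0 = 4 * branchAngle g 0 + branchAngle g 0 by ring, Real.cos_add, cos_four_a,
    sin_four_a]
  have h := cmid_sq_add_shalf_sq g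
  unfold cmid shalf at *
  have e : Real.sin (branchAngle g 0) ^ 2 = 1 - Real.cos (branchAngle g 0) ^ 2 := by linarith
  calc (8 * Real.cos (branchAngle g 0) ^ 4 - 8 * Real.cos (branchAngle g 0) ^ 2 + 1) * Real.cos (branchAngle g 0) -
        4 * Real.sin (branchAngle g 0) * Real.cos (branchAngle g 0) * (2 * Real.cos (branchAngle g 0) ^ 2 - 1) *
          Real.sin (branchAngle g 0)
        = (8 * Real.cos (branchAngle g 0) ^ 4 - 8 * Real.cos (branchAngle g 0) ^ 2 + 1) * Real.cos (branchAngle g 0) -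
          4 * Real.cos (branchAngle g 0) * (2 * Real.cos (branchAngle g 0) ^ 2 - 1) * Real.sin (branchAngle g 0) ^ 2 := by
          ring
    _ = _ := by rw [e]; ring

/-- `cos θ_0 − cos 3θ_0 = 4 c s² ≥ 0` (`g ≥ 1`). [folklore] -/
theorem cos_three_a_le_cmid (hg : 1 ≤ g) : Real.cos (3 * branchAngle g 0) ≤ cmid g := by
  rw [cos_three_a]
  have h := cmid_sq_add_shalf_sq g
  have hc : 0 ≤ cmid g := by linarith [half_le_cmid hg]
  nlinarith [sq_nonneg (shalf g), mul_nonneg hc (sq_nonneg (shalf g))]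

/-- **`cos θ ≤ cos 5θ_0` for `θ ∈ [5θ_0, 2π − 5θ_0]`** (`5θ_0 ≤ π`, i.e. `g ≥ 2`). [folklore] -/
theorem cos_le_cos_five_a (hg : 2 ≤ g) {θ : ℝ} (h1 : 5 * branchAngle g 0 ≤ θ)
    (h2 : θ ≤ 2 * π - 5 * branchAngle g 0) : Real.cos θ ≤ Real.cos (5 * branchAngle g 0) := by
  have h5 : 5 * branchAngle g 0 ≤ π := by
    have := mul_branchAngle_zero g
    have hg' : (2 : ℝ) ≤ g := by exact_mod_cast hg
    nlinarith [branchAngle_zero_pos g]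
  have h0 : 0 ≤ 5 * branchAngle g 0 := by linarith [branchAngle_zero_pos g]
  rcases le_or_gt θ π with hθ | hθ
  · exact Real.cos_le_cos_of_nonneg_of_le_pi h0 hθ h1
  · rw [← Real.cos_two_pi_sub]
    exact Real.cos_le_cos_of_nonneg_of_le_pi h0 (by linarith) (by linarith)

/-- `ω = e^{2iθ_0}`. [folklore] -/
theorem rootU_eq_exp_a (g : ℕ) : rootU (2 * g + 1) = cexp (((2 * branchAngle g 0 : ℝ) : ℂ) * I) := by
  unfold rootU
  congr 1
  unfold branchAngle
  have h0 : ((2 * g + 1 : ℕ) : ℂ) ≠ 0 := Nat.cast_ne_zero.2 (by omega)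
  push_cast at h0 ⊢
  field_simp
  ring

/-- `ϖ = ω² = e^{4iθ_0}`. [folklore] -/
theorem rootU_sq_eq_exp (g : ℕ) : rootU (2 * g + 1) ^ 2 = cexp (((4 * branchAngle g 0 : ℝ) : ℂ) * I) := by
  rw [rootU_eq_exp_a, ← Complex.exp_nat_mul _ 2]
  congr 1; push_cast; ring

/-- `‖ϖ‖ = 1`. [folklore] -/
theorem norm_rootU_sq (g : ℕ) : ‖rootU (2 * g + 1) ^ 2‖ = 1 := by
  rw [rootU_sq_eq_exp, Complex.norm_exp_ofReal_mul_I]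

/-- **The reduced angle** of the `k`-th branch point: `θ_k − 4θ_0 = (2k − 3) θ_0`. [folklore] -/
theorem branchPt_eq_rot_mul (g k : ℕ) :
    branchPt g k = rootU (2 * g + 1) ^ 2 * cexp (((branchAngle g k - 4 * branchAngle g 0 : ℝ) : ℂ) * I) := by
  rw [rootU_sq_eq_exp, ← Complex.exp_add, branchPt]
  congr 1; push_cast; ring

/-- **Enclosed angles**: `cos 3θ_0 ≤ cos (θ_k − 4θ_0)` for `k < 4` (`θ_k − 4θ_0 ∈ {−3, −1, 1, 3}·θ_0`).
[folklore] -/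
theorem cos_three_a_le_cos_red (hg : 1 ≤ g) {k : ℕ} (hk : k < 4) :
    Real.cos (3 * branchAngle g 0) ≤ Real.cos (branchAngle g k - 4 * branchAngle g 0) := by
  have h3 := cos_three_a_le_cmid hg
  interval_cases k
  · rw [show branchAngle g 0 - 4 * branchAngle g 0 = -(3 * branchAngle g 0) by ring, Real.cos_neg]
  · rw [branchAngle_eq_mul g 1, show ((2 * ((1 : ℕ) : ℝ) + 1) * branchAngle g 0 - 4 * branchAngle g 0)
      = -branchAngle g 0 by push_cast; ring, Real.cos_neg]; exact h3
  · rw [branchAngle_eq_mul g 2, show ((2 * ((2 : ℕ) : ℝ) + 1) * branchAngle g 0 - 4 * branchAngle g 0)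
      = branchAngle g 0 by push_cast; ring]; exact h3
  · rw [branchAngle_eq_mul g 3, show ((2 * ((3 : ℕ) : ℝ) + 1) * branchAngle g 0 - 4 * branchAngle g 0)
      = 3 * branchAngle g 0 by push_cast; ring]

/-- **Excluded angles**: `cos (θ_k − 4θ_0) ≤ cos 5θ_0` for `4 ≤ k ≤ 2g` (`θ_k − 4θ_0 ∈ [5θ_0, 2π − 5θ_0]`).
[folklore] -/
theorem cos_red_le_cos_five_a (hg : 2 ≤ g) {k : ℕ} (hk : 4 ≤ k) (hkn : k < 2 * g + 1) :
    Real.cos (branchAngle g k - 4 * branchAngle g 0) ≤ Real.cos (5 * branchAngle g 0) := by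
  have hk' : (4 : ℝ) ≤ k := by exact_mod_cast hk
  have hkn' : (k : ℝ) + 1 ≤ 2 * g + 1 := by exact_mod_cast hkn
  have hπ := mul_branchAngle_zero g
  have ha := branchAngle_zero_pos g
  refine cos_le_cos_five_a hg ?_ ?_
  · rw [branchAngle_eq_mul g k]; nlinarith
  · rw [branchAngle_eq_mul g k]; nlinarith

/-! ## §2 The centre, the radius and the distances to the branch points -/

/-- **The centre** `c₀ = (2/5) ϖ` of the four-point loop. [folklore] -/
def eoCenter (g : ℕ) : ℂ := (2 / 5 : ℂ) * rootU (2 * g + 1) ^ 2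

/-- **The radius** `R = ‖ϖ − 2/5‖` of the four-point loop (the circle passes through `1` and `ϖ²`).
[folklore] -/
def eoRad (g : ℕ) : ℝ := ‖rootU (2 * g + 1) ^ 2 - 2 / 5‖

/-- **The half-width** `κ = (1 − cos θ_0)/10` of the annulus chart around the loop. [folklore] -/
def eoKap (g : ℕ) : ℝ := (1 - cmid g) / 10

/-- `‖c₀‖ = 2/5`. [folklore] -/
theorem norm_eoCenter (g : ℕ) : ‖eoCenter g‖ = 2 / 5 := by
  rw [eoCenter, norm_mul, norm_rootU_sq, mul_one]; norm_num

/-- **`‖e^{iθ} − t‖² = 1 + t² − 2t cos θ`.** [folklore] -/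
theorem norm_exp_sub_real_sq (θ t : ℝ) : ‖cexp ((θ : ℂ) * I) - t‖ ^ 2 = 1 + t ^ 2 - 2 * t * Real.cos θ := by
  rw [Complex.sq_norm, Complex.normSq_apply]
  simp only [Complex.sub_re, Complex.sub_im, Complex.exp_ofReal_mul_I_re, Complex.exp_ofReal_mul_I_im,
    Complex.ofReal_re, Complex.ofReal_im, sub_zero]
  nlinarith [Real.cos_sq_add_sin_sq θ]

/-- `‖ϖ z‖ = ‖z‖`. [folklore] -/
theorem norm_rootU_sq_mul (g : ℕ) (z : ℂ) : ‖rootU (2 * g + 1) ^ 2 * z‖ = ‖z‖ := by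
  rw [norm_mul, norm_rootU_sq, one_mul]

/-- **`R² = 1 + 4/25 − (4/5) cos 4θ_0`.** [folklore] -/
theorem eoRad_sq (g : ℕ) : eoRad g ^ 2 = 1 + (2 / 5) ^ 2 - 2 * (2 / 5) * Real.cos (4 * branchAngle g 0) := by
  rw [eoRad, rootU_sq_eq_exp, ← norm_exp_sub_real_sq]; norm_num

/-- `0 ≤ R`. [folklore] -/
theorem eoRad_nonneg (g : ℕ) : 0 ≤ eoRad g := norm_nonneg _

/-- `R ≤ 1.36` (`cos 4θ_0 = 8c⁴ − 8c² + 1 ≥ −0.85` for `c ≥ 4/5`), `g ≥ 2`. [folklore] -/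
theorem eoRad_le (hg : 2 ≤ g) : eoRad g ≤ 1.36 := by
  have h := eoRad_sq g
  rw [cos_four_a] at h
  have hc := cmid_ge hg
  have hc1 := (cmid_lt_one (by omega : 1 ≤ g)).le
  have hu : 0.64 ≤ cmid g ^ 2 := by nlinarith
  have h4 : -0.85 ≤ 8 * cmid g ^ 4 - 8 * cmid g ^ 2 + 1 := by
    have e : 8 * cmid g ^ 4 - 8 * cmid g ^ 2 + 1 + 0.85 = 8 * (cmid g ^ 2 - 0.64) * (cmid g ^ 2 - 0.36) + 0.0068 := by
      ring
    nlinarith [mul_nonneg (by linarith : (0:ℝ) ≤ cmid g ^ 2 - 0.64) (by linarith : (0:ℝ) ≤ cmid g ^ 2 - 0.36)]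
  nlinarith [eoRad_nonneg g]

/-- `0.6 ≤ R`. [folklore] -/
theorem eoRad_ge (g : ℕ) : 0.6 ≤ eoRad g := by
  have h := eoRad_sq g
  have := Real.cos_le_one (4 * branchAngle g 0)
  nlinarith [eoRad_nonneg g]

/-- `0 ≤ κ ≤ 1/50` (`g ≥ 2`). [folklore] -/
theorem eoKap_bounds (hg : 2 ≤ g) : 0 ≤ eoKap g ∧ eoKap g ≤ 1 / 50 := by
  have := cmid_ge hg; have := cmid_lt_one (by omega : 1 ≤ g)
  unfold eoKap; constructor <;> linarith

/-- **The distance of `ζ_k` to the centre**: `‖ζ_k − c₀‖² = 1 + 4/25 − (4/5) cos((2k+1)θ_0 − 4θ_0)`.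
[folklore] -/
theorem norm_branchPt_sub_center_sq (g k : ℕ) :
    ‖branchPt g k - eoCenter g‖ ^ 2 =
      1 + (2 / 5) ^ 2 - 2 * (2 / 5) * Real.cos (branchAngle g k - 4 * branchAngle g 0) := by
  rw [branchPt_eq_rot_mul, eoCenter, show rootU (2 * g + 1) ^ 2 * cexp (((branchAngle g k - 4 * branchAngle g 0 : ℝ) : ℂ) * I)
      - 2 / 5 * rootU (2 * g + 1) ^ 2 = rootU (2 * g + 1) ^ 2 *
        (cexp (((branchAngle g k - 4 * branchAngle g 0 : ℝ) : ℂ) * I) - (((2 / 5 : ℝ)) : ℂ)) by push_cast; ring,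
    norm_rootU_sq_mul, norm_exp_sub_real_sq]

/-- **The four enclosed branch points**: `‖ζ_k − c₀‖ < R − 5κ` for `k < 4` (`g ≥ 2`). [folklore] -/
theorem norm_branchPt_sub_center_lt (hg : 2 ≤ g) {k : ℕ} (hk : k < 4) :
    ‖branchPt g k - eoCenter g‖ < eoRad g - 5 * eoKap g := by
  have hc := cmid_ge hg
  have hc1 := cmid_lt_one (by omega : 1 ≤ g)
  have hcos := cos_three_a_le_cos_red (g := g) (by omega) hk
  have hd := norm_branchPt_sub_center_sq g k
  have hR := eoRad_sq g
  rw [cos_four_a] at hR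
  rw [cos_three_a] at hcos
  set d := ‖branchPt g k - eoCenter g‖ with hd_def
  have hd0 : 0 ≤ d := norm_nonneg _
  have hRle := eoRad_le hg
  -- `R² − d² ≥ (4/5)(cos 3θ_0 − cos 4θ_0) ≥ 1.6 (1 − c)`
  have key : 1.6 * (1 - cmid g) ≤ eoRad g ^ 2 - d ^ 2 := by
    have h1 : eoRad g ^ 2 - d ^ 2 ≥ 2 * (2 / 5) * ((4 * cmid g ^ 3 - 3 * cmid g) - (8 * cmid g ^ 4 - 8 * cmid g ^ 2 + 1)) := by
      nlinarith
    have h2 : (4 * cmid g ^ 3 - 3 * cmid g) - (8 * cmid g ^ 4 - 8 * cmid g ^ 2 + 1) =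
        (1 - cmid g) * (8 * cmid g ^ 3 + 4 * cmid g ^ 2 - 4 * cmid g - 1) := by ring
    have h3 : 2 ≤ 8 * cmid g ^ 3 + 4 * cmid g ^ 2 - 4 * cmid g - 1 := by nlinarith
    nlinarith [mul_le_mul_of_nonneg_left h3 (by linarith : (0:ℝ) ≤ 1 - cmid g)]
  have hk : 5 * eoKap g = (1 - cmid g) / 2 := by unfold eoKap; ring
  rw [hk]
  -- `R − d ≥ (R² − d²)/(R + d)` with `R + d ≤ 2.8`
  have hdle : d ≤ eoRad g := le_of_pow_le_pow_left₀ two_ne_zero (eoRad_nonneg g) (by nlinarith)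
  have hsum : d + eoRad g ≤ 2.8 := by linarith
  have hprod : (eoRad g - d) * 2.8 ≥ 1.6 * (1 - cmid g) := by
    have e : eoRad g ^ 2 - d ^ 2 = (eoRad g - d) * (d + eoRad g) := by ring
    nlinarith [mul_le_mul_of_nonneg_left hsum (sub_nonneg.2 hdle)]
  nlinarith

/-- **The excluded branch points**: `R + 2κ < ‖ζ_k − c₀‖` for `4 ≤ k ≤ 2g` (`g ≥ 2`). [folklore] -/
theorem lt_norm_branchPt_sub_center (hg : 2 ≤ g) {k : ℕ} (hk : 4 ≤ k) (hkn : k < 2 * g + 1) :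
    eoRad g + 2 * eoKap g < ‖branchPt g k - eoCenter g‖ := by
  have hc := cmid_ge hg
  have hc1 := cmid_lt_one (by omega : 1 ≤ g)
  have hcos := cos_red_le_cos_five_a hg hk hkn
  have hd := norm_branchPt_sub_center_sq g k
  have hR := eoRad_sq g
  rw [cos_four_a] at hR
  rw [cos_five_a] at hcos
  set d := ‖branchPt g k - eoCenter g‖ with hd_def
  have hd0 : 0 ≤ d := norm_nonneg _
  have hRle := eoRad_le hg
  have key : 0.608 * (1 - cmid g) ≤ d ^ 2 - eoRad g ^ 2 := by
    have h1 : d ^ 2 - eoRad g ^ 2 ≥ 2 * (2 / 5) * ((8 * cmid g ^ 4 - 8 * cmid g ^ 2 + 1) -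
        (16 * cmid g ^ 5 - 20 * cmid g ^ 3 + 5 * cmid g)) := by nlinarith
    have h2 : (8 * cmid g ^ 4 - 8 * cmid g ^ 2 + 1) - (16 * cmid g ^ 5 - 20 * cmid g ^ 3 + 5 * cmid g) =
        (1 - cmid g) * (16 * cmid g ^ 4 + 8 * cmid g ^ 3 - 12 * cmid g ^ 2 - 4 * cmid g + 1) := by ring
    have h3 : 0.76 ≤ 16 * cmid g ^ 4 + 8 * cmid g ^ 3 - 12 * cmid g ^ 2 - 4 * cmid g + 1 := by
      have e : 16 * cmid g ^ 4 + 8 * cmid g ^ 3 - 12 * cmid g ^ 2 - 4 * cmid g + 1 =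
          (cmid g - 0.8) * (16 * cmid g ^ 3 + 20.8 * cmid g ^ 2 + 4.64 * cmid g - 0.288) + 0.7696 := by ring
      have hq : 0 ≤ 16 * cmid g ^ 3 + 20.8 * cmid g ^ 2 + 4.64 * cmid g - 0.288 := by nlinarith
      nlinarith [mul_nonneg (by linarith : (0:ℝ) ≤ cmid g - 0.8) hq]
    nlinarith [mul_le_mul_of_nonneg_left h3 (by linarith : (0:ℝ) ≤ 1 - cmid g)]
  have hk2 : 2 * eoKap g = (1 - cmid g) / 5 := by unfold eoKap; ring
  rw [hk2]
  have hd1 : d ≤ 1 + 2 / 5 := by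
    have : d ≤ ‖branchPt g k‖ + ‖eoCenter g‖ := norm_sub_le _ _
    rw [norm_branchPt, norm_eoCenter] at this; exact this
  have hdge : eoRad g ≤ d := le_of_pow_le_pow_left₀ two_ne_zero hd0 (by nlinarith)
  have hsum : d + eoRad g ≤ 2.76 := by linarith
  have hprod : (d - eoRad g) * 2.76 ≥ 0.608 * (1 - cmid g) := by
    have e : d ^ 2 - eoRad g ^ 2 = (d - eoRad g) * (d + eoRad g) := by ring
    nlinarith [mul_le_mul_of_nonneg_left hsum (sub_nonneg.2 hdge)]
  nlinarith

/-- `2/5 + R + κ ≤ 1.78` (`g ≥ 2`): the chart stays in `‖x‖ ≤ 1.78`, where the page scaling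
`(3/2)^{1/(2g+1)} ≤ 1.09` keeps it in the flat region `‖x‖ < 2`. [folklore] -/
theorem center_add_rad_add_kap_le (hg : 2 ≤ g) : 2 / 5 + eoRad g + eoKap g ≤ 1.78 := by
  have := eoRad_le hg; have := (eoKap_bounds hg).2; linarith

/-- **Sub-goal `helper_eOne_radii`** (H5-1, plane geometry of the round four-point loop of
(R-E1CURVE), node N3a of NF4): with `c₀ = eoCenter g`, `R = eoRad g`, `κ = eoKap g` (`g ≥ 2`), the
branch points `ζ_0, …, ζ_3` are at distance `< R − 5κ` from `c₀` and `ζ_4, …, ζ_{2g}` at distance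
`> R + 2κ`: the annulus `R − κ ≤ ‖x − c₀‖ ≤ R + κ` of the chart contains no branch point and its
circles enclose exactly four of them. [folklore] -/
theorem helper_eOne_radii : ∀ (g : ℕ) (_hg : 2 ≤ g) (k : ℕ), (k < 4 → ‖Literature.Topology.FourManifolds.LefschetzBase.branchPt g k - Summit.SmoothPoincare4.SmoothPoincare4.Theorems.AcyclicBisectionExists.ModpBraidOrbits.eoCenter g‖ < Summit.SmoothPoincare4.SmoothPoincare4.Theorems.AcyclicBisectionExists.ModpBraidOrbits.eoRad g - 5 * Summit.SmoothPoincare4.SmoothPoincare4.Theorems.AcyclicBisectionExists.ModpBraidOrbits.eoKap g) ∧ (4 ≤ k → k < 2 * g + 1 → Summit.SmoothPoincare4.SmoothPoincare4.Theorems.AcyclicBisectionExists.ModpBraidOrbits.eoRad g + 2 * Summit.SmoothPoincare4.SmoothPoincare4.Theorems.AcyclicBisectionExists.ModpBraidOrbits.eoKap g < ‖Literature.Topology.FourManifolds.LefschetzBase.branchPt g k - Summit.SmoothPoincare4.SmoothPoincare4.Theorems.AcyclicBisectionExists.ModpBraidOrbits.eoCenter g‖) :=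
  fun _ hg _ => ⟨fun hk => norm_branchPt_sub_center_lt hg hk, fun hk hkn => lt_norm_branchPt_sub_center hg hk hkn⟩

end Summit.SmoothPoincare4.SmoothPoincare4.Theorems.AcyclicBisectionExists.ModpBraidOrbits

end
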